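import Summits.PneNP.PneNP.Theses.RamseyUncertifiable

/-!
# Line `forster-latent-regime` for the crux `SosUncertainty` (stmt-PneNP-9815)

Crux (route `RamseyUncertifiable`, rank 2), verbatim:
`∀ t ≥ 1, ∃ δ > 0, ∃ n₀, ∀ n ≥ n₀, ∀ G : SimpleGraph (Fin n), n ^ δ ≤ las_t(G) · las_t(Gᶜ)`.

## The line (idea card `Ideas/forster-latent-regime.md`, sharpened at crux-plan; card `Lines/forster-latent-regime.md`)

The idea: Forster's inequality (a sign matrix realised in `ℝ^d`, or with margin `γ`, has `d ≥ m/‖M‖`,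
`1/γ ≥ m/‖M‖`) separates the graphs on which UP is known or believed with existing technology
(G(n,½), Paley: spectrally pseudorandom ⇒ margin complexity `≥ √n`-type) from the structured weakly-Ramsey
families on which UP is in doubt (Frankl–Wilson, latent-geometric graphs: sign patterns of low-dimensional
point configurations). The Linial–Shraibman theorem `disc(A) ≤ m(A) ≤ 8·disc(A)` (margin `m(A)` of the best
unit-vector sign realisation versus the least weighted rectangle discrepancy; Combin. Probab. Comput. 18
(2009) 227–245, Thm 3.1, doi:10.1017/s0963548308009656, READ p. 230) makes this separation an EXHAUSTIVE
dichotomy that hands usable structure to both sides: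

* `stub_marginDiscrepancyDichotomy` (KNOWN — LS09 Thm 3.1 + Johnson–Lindenstrauss): for every `η > 0` and
  large `n`, every graph on `Fin n` either has a unit-vector sign realisation of its Seidel matrix with margin
  `n^{-η}` in dimension `⌊n^{3η}⌋` (ROBUST LATENT GEOMETRY), or a probability weighting `μ` of the vertex pairs
  under which every combinatorial rectangle is balanced to `n^{-η/2}` (WEIGHTED PSEUDORANDOMNESS).
* `stub_lowMarginUncertainty` (OPEN, the doubted half — hardest): UP at every level `t` on robust latent
  geometry, for some `η = η(t) > 0`. Frankl–Wilson graphs live here (margin `n^{-O(1/q)}` through the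
  polynomial feature map of `|A ∩ B| mod q`), so do substitution towers; bounded dimension is the
  semi-algebraic Erdős–Hajnal regime (hom(G) polynomial ⇒ UP free).
* `stub_lowDiscrepancyUncertainty` (OPEN, the believed half): UP at every level for every polynomial
  discrepancy rate `n^{-ε}` — derandomised BHKKMP / Kunisky–Yu from the weakest pseudorandomness notion;
  `μ` uniform on an induced G(m,½) = BHKKMP 2016/19, on a Paley graph = KY22 (level 2); `μ` uniform on the
  NEAR-ORTHOGONAL pairs = the idea's latent family G(n, polylog n, ½), for which the idea's lever
  (pseudo-calibration with the randomness moved from edges to the latent Gaussian points, planted on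
  barely-acute pairs) is the proposed tool.

`of_parts` is the case split with the crux unfolded (sorry-free, axioms `propext, Classical.choice,
Quot.sound`); `SosUncertainty_of` concludes the route decl BY NAME from the three registered stubs.
Both open stubs are implied by the crux (restrictions of it), so given stub 1 the line is an EQUIVALENT
regime split: `SosUncertainty ⟺ stub 2 ∧ stub 3` — nothing false can be chased, nothing is lost.

Disproof.lean (2026-08-16T05:02Z) honoured: every stub keeps `1 ≤ t` (`sosUncertainty_false_without_level_pos`
— used in both open stubs, whose conclusions are products of `las_t`, junk at `t = 0`); the exponents `δ` are
existential and depend on `t` (and on `ε`): no uniform exponent (`not_uniformSosUncertainty_of_families`), no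
`δ = 1` / `n₀ = 1` shape (`not_levelTwo_lovaszShape`), no `δ > 1` (`not_sosUncertainty_superlinear`). No landed
Negative lemma exists under `Theorems/SosUncertainty/Negative/` (gate note in Disproof.lean (e)).
-/

set_option linter.dupNamespace false

namespace Summit.PneNP.PneNP.Cruxes.SosUncertainty.ForsterLatentRegime

open Literature.Combinatorics.SimpleGraph Finset
open Summit.PneNP.PneNP.Theses.RamseyUncertifiable (SosUncertainty)

/-! ## The one object of the line (a data definition, not a proposition) -/

/-- The **Seidel sign matrix** of a graph on `Fin n`: `−1` on edges, `+1` on non-edges, hence `+1` on the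
diagonal — a genuine `n × n` sign matrix (the `S_U + I` of the idea card; Forster / Linial–Shraibman apply
to it verbatim). -/
noncomputable def seidelSign {n : ℕ} (G : SimpleGraph (Fin n)) (u v : Fin n) : ℝ := by
  classical exact if G.Adj u v then -1 else 1

/-! ## Registered stubs

Inlined predicates (kept inline so that the file defines no propositions of its own):
* ROBUST LATENT GEOMETRY `Margin(G; r, γ)` := `∃ X Y : Fin n → Fin r → ℝ` with unit rows and
  `γ ≤ S_{uv} ⟨X_u, Y_v⟩` for all `u ≠ v` (LS09's margin `m(S) ≥ γ`, realised in dimension `r`);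
* WEIGHTED PSEUDORANDOMNESS `Disc(G; ε)` := `∃ μ ≥ 0`, `Σ μ = 1`, `|Σ_{u∈A, v∈B} μ_{uv} S_{uv}| ≤ ε` for all
  `A, B ⊆ Fin n` (LS09's `disc(S) ≤ ε`, `disc_P = max_R |P⁺(R) − P⁻(R)|`). -/

/-- **Stub 1 — margin/discrepancy dichotomy (KNOWN; size L).** Linial–Shraibman 2009 Thm 3.1
(`disc(A) ≤ m(A) ≤ 8·disc(A)` for every sign matrix) + Johnson–Lindenstrauss: for `η > 0` and `n ≥ n₀(η)`,
every graph has `Margin(G; ⌊n^{3η}⌋, n^{-η})` or `Disc(G; n^{-η/2})`.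
Proof sketch: `S := seidelSign G` is an `n × n` sign matrix. If `m(S) ≥ 4n^{-η}`, a realisation with margin
`≥ 2n^{-η}` exists in `ℝ^{2n}` (LS09 (1.1): no gain in higher dimension); a Gaussian projection to
`C n^{2η} log n ≤ n^{3η}` coordinates followed by renormalisation keeps margin `≥ n^{-η}` (JL on the `2n` unit
vectors and their `n²` inner products). Otherwise `disc(S) ≤ m(S) < 4n^{-η} ≤ n^{-η/2}` once `n ≥ 4^{2/η}`,
and `disc` is attained by some probability `μ` (a minimum over the simplex). Not in Mathlib: JL for finite
point sets, Grothendieck's inequality and the LP duality of LS09 §3. -/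
theorem stub_marginDiscrepancyDichotomy :
    ∀ η : ℝ, 0 < η → ∃ n₀ : ℕ, ∀ n ≥ n₀, ∀ G : SimpleGraph (Fin n),
        (∃ X Y : Fin n → Fin ⌊(n : ℝ) ^ (3 * η)⌋₊ → ℝ, (∀ u, ∑ k, X u k ^ 2 = 1) ∧ (∀ v, ∑ k, Y v k ^ 2 = 1) ∧
          ∀ u v, u ≠ v → (n : ℝ) ^ (-η) ≤ seidelSign G u v * ∑ k, X u k * Y v k) ∨
        (∃ μ : Fin n → Fin n → ℝ, (∀ u v, 0 ≤ μ u v) ∧ ∑ u, ∑ v, μ u v = 1 ∧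
          ∀ A B : Finset (Fin n), |∑ u ∈ A, ∑ v ∈ B, μ u v * seidelSign G u v| ≤ (n : ℝ) ^ (-(η / 2))) := by
  sorry

/-- **Stub 2 — uncertainty on robust latent geometry (OPEN; the doubted half; HARDEST).** For every
level `t ≥ 1` there is `η = η(t) > 0` such that `Margin(G; ⌊n^{3η}⌋, n^{-η}) ⇒ las_t(G)·las_t(Ḡ) ≥ n^{δ}`
for `n ≥ n₀`. Implied by the crux (a restriction of it); its negation refutes the crux, and this is where
every recorded doubt lives: Frankl–Wilson / Grolmusz graphs (`hom = n^{O(1/q)}`, margin `n^{-O(1/q)}`: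
realise `1[|A∩B| ≡ −1 (q)]` by `f(⟨1_A,1_B⟩)`, `deg f = 2q − 2`, feature dimension `≤ 2m^{2q−2} = n^{O(1/q)}`),
Disproof.lean (e)(4) (a fixed SoS level might certify both sides there), and the idea's own kill-switch F2
read for algebraic configurations. Plausible because: (i) bounded dimension `r = O(1)` is FREE — sign-rank-`r`
graphs are semi-algebraic of bounded complexity, so hom(G) ≥ n^{c(r)} (Alon–Pach–Pinchasi–Radoičić–Sharir
2005) and `las_t ≥ α` (tree `indepNum_le_lasserreStableBound`) gives the product; (ii) level `t = 1` holds
for all graphs (tree `thetaUncertainty_proof`); (iii) for Frankl–Wilson the coclique side is the MODULAR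
RW theorem — counting mod `q`, the kind of reasoning whose SoS degree grows with the modulus (sibling idea
`johnson-scheme-modular-blindness`). Size: XL / open. -/
theorem stub_lowMarginUncertainty :
    ∀ t : ℕ, 1 ≤ t → ∃ η : ℝ, 0 < η ∧ ∃ δ : ℝ, 0 < δ ∧ ∃ n₀ : ℕ, ∀ n ≥ n₀,
      ∀ G : SimpleGraph (Fin n),
        (∃ X Y : Fin n → Fin ⌊(n : ℝ) ^ (3 * η)⌋₊ → ℝ, (∀ u, ∑ k, X u k ^ 2 = 1) ∧ (∀ v, ∑ k, Y v k ^ 2 = 1) ∧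
          ∀ u v, u ≠ v → (n : ℝ) ^ (-η) ≤ seidelSign G u v * ∑ k, X u k * Y v k) →
          (n : ℝ) ^ δ ≤ lasserreStableBound G t * lasserreStableBound Gᶜ t := by
  sorry

/-- **Stub 3 — uncertainty from weighted discrepancy (OPEN; the believed half).** For every level
`t ≥ 1` and rate `ε > 0`: `Disc(G; n^{-ε}) ⇒ las_t(G)·las_t(Ḡ) ≥ n^{δ(t,ε)}` for `n ≥ n₀`. Implied by the
crux. Known instances: `μ` uniform on an induced `G(m,½)`, `m = n^{2ε}` (BHKKMP, arXiv:1604.03084, all `t`;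
plus `las_t(G) ≥ las_t(G[U])`), Paley `P_p` at `t = 2` (Kunisky–Yu arXiv:2211.02713, `las₂ ≥ p^{1/3}`),
all graphs at `t = 1` (Lovász). The idea's latent family `G(n, d, ½)`, `d = polylog n` — hereditarily NOT
spectrally pseudorandom (Forster: `‖S_U‖ ≥ |U|/d − 1` for every `U`) — is expected to satisfy the
hypothesis with `μ` uniform on the near-orthogonal pairs `|⟨x_u,x_v⟩| ≤ n^{-c}/√d` (heuristic
`disc_μ ≈ n^{-1/3}`; kit probe j013615), and the idea's lever (pseudo-calibration in the latent Hermite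
variables, planted clique on barely-acute pairs, quiet up to `k ≲ √(n/d)`) is the proposed tool there.
Why it might fail AS A TOOL STATEMENT: rectangle discrepancy is much weaker than the graph-matrix norm
control pseudo-calibration consumes (KY22 needs `S² = qI − J` exactly); the weighting `μ` handed over may sit
on a structure nobody can calibrate against. Size: XL / open. -/
theorem stub_lowDiscrepancyUncertainty :
    ∀ t : ℕ, 1 ≤ t → ∀ ε : ℝ, 0 < ε → ∃ δ : ℝ, 0 < δ ∧ ∃ n₀ : ℕ, ∀ n ≥ n₀,
      ∀ G : SimpleGraph (Fin n),
        (∃ μ : Fin n → Fin n → ℝ, (∀ u v, 0 ≤ μ u v) ∧ ∑ u, ∑ v, μ u v = 1 ∧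
          ∀ A B : Finset (Fin n), |∑ u ∈ A, ∑ v ∈ B, μ u v * seidelSign G u v| ≤ (n : ℝ) ^ (-ε)) →
          (n : ℝ) ^ δ ≤ lasserreStableBound G t * lasserreStableBound Gᶜ t := by
  sorry

/-! ## Composition -/

/-- **The case split, closed form (sorry-free):** dichotomy + the two restricted uncertainty principles
give the crux, stated UNFOLDED here so that only `SosUncertainty_of` concludes the route decl by name.
`δ := min (δ_low t) (δ_high t (η t / 2))`, `n₀ := max of the three thresholds and 1`. -/
theorem of_parts
    (hD : ∀ η : ℝ, 0 < η → ∃ n₀ : ℕ, ∀ n ≥ n₀, ∀ G : SimpleGraph (Fin n),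
        (∃ X Y : Fin n → Fin ⌊(n : ℝ) ^ (3 * η)⌋₊ → ℝ, (∀ u, ∑ k, X u k ^ 2 = 1) ∧ (∀ v, ∑ k, Y v k ^ 2 = 1) ∧
          ∀ u v, u ≠ v → (n : ℝ) ^ (-η) ≤ seidelSign G u v * ∑ k, X u k * Y v k) ∨
        (∃ μ : Fin n → Fin n → ℝ, (∀ u v, 0 ≤ μ u v) ∧ ∑ u, ∑ v, μ u v = 1 ∧
          ∀ A B : Finset (Fin n), |∑ u ∈ A, ∑ v ∈ B, μ u v * seidelSign G u v| ≤ (n : ℝ) ^ (-(η / 2))))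
    (hL : ∀ t : ℕ, 1 ≤ t → ∃ η : ℝ, 0 < η ∧ ∃ δ : ℝ, 0 < δ ∧ ∃ n₀ : ℕ, ∀ n ≥ n₀,
      ∀ G : SimpleGraph (Fin n),
        (∃ X Y : Fin n → Fin ⌊(n : ℝ) ^ (3 * η)⌋₊ → ℝ, (∀ u, ∑ k, X u k ^ 2 = 1) ∧ (∀ v, ∑ k, Y v k ^ 2 = 1) ∧
          ∀ u v, u ≠ v → (n : ℝ) ^ (-η) ≤ seidelSign G u v * ∑ k, X u k * Y v k) →
          (n : ℝ) ^ δ ≤ lasserreStableBound G t * lasserreStableBound Gᶜ t)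
    (hH : ∀ t : ℕ, 1 ≤ t → ∀ ε : ℝ, 0 < ε → ∃ δ : ℝ, 0 < δ ∧ ∃ n₀ : ℕ, ∀ n ≥ n₀,
      ∀ G : SimpleGraph (Fin n),
        (∃ μ : Fin n → Fin n → ℝ, (∀ u v, 0 ≤ μ u v) ∧ ∑ u, ∑ v, μ u v = 1 ∧
          ∀ A B : Finset (Fin n), |∑ u ∈ A, ∑ v ∈ B, μ u v * seidelSign G u v| ≤ (n : ℝ) ^ (-ε)) →
          (n : ℝ) ^ δ ≤ lasserreStableBound G t * lasserreStableBound Gᶜ t) :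
    ∀ t : ℕ, 1 ≤ t → ∃ δ : ℝ, 0 < δ ∧ ∃ n₀ : ℕ, ∀ n ≥ n₀, ∀ G : SimpleGraph (Fin n),
      (n : ℝ) ^ δ ≤ lasserreStableBound G t * lasserreStableBound Gᶜ t := by
  intro t ht
  obtain ⟨η, hη, δ₁, hδ₁, n₁, h₁⟩ := hL t ht
  obtain ⟨δ₂, hδ₂, n₂, h₂⟩ := hH t ht (η / 2) (by positivity)
  obtain ⟨n₃, h₃⟩ := hD η hη
  refine ⟨min δ₁ δ₂, lt_min hδ₁ hδ₂, max (max n₁ n₂) (max n₃ 1), ?_⟩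
  intro n hn G
  have hn₁ : n₁ ≤ n := le_trans (le_trans (le_max_left _ _) (le_max_left _ _)) hn
  have hn₂ : n₂ ≤ n := le_trans (le_trans (le_max_right _ _) (le_max_left _ _)) hn
  have hn₃ : n₃ ≤ n := le_trans (le_trans (le_max_left _ _) (le_max_right _ _)) hn
  have hn1 : 1 ≤ n := le_trans (le_trans (le_max_right _ _) (le_max_right _ _)) hn
  have hnR : (1 : ℝ) ≤ (n : ℝ) := by exact_mod_cast hn1
  rcases h₃ n hn₃ G with hcase | hcase
  · calc (n : ℝ) ^ min δ₁ δ₂ ≤ (n : ℝ) ^ δ₁ :=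
          Real.rpow_le_rpow_of_exponent_le hnR (min_le_left _ _)
      _ ≤ lasserreStableBound G t * lasserreStableBound Gᶜ t := h₁ n hn₁ G hcase
  · calc (n : ℝ) ^ min δ₁ δ₂ ≤ (n : ℝ) ^ δ₂ :=
          Real.rpow_le_rpow_of_exponent_le hnR (min_le_right _ _)
      _ ≤ lasserreStableBound G t * lasserreStableBound Gᶜ t := h₂ n hn₂ G hcase

/-- **Skeleton theorem**: the crux BY NAME from the three registered stubs (one known, two open). -/
theorem SosUncertainty_of : SosUncertainty :=
  of_parts stub_marginDiscrepancyDichotomy stub_lowMarginUncertainty stub_lowDiscrepancyUncertainty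

end Summit.PneNP.PneNP.Cruxes.SosUncertainty.ForsterLatentRegime
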